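import Literature.Probability.FitznerVanDerHofstad2017.NbwRemainderFrame
import Literature.Probability.FitznerVanDerHofstad2017.DoubleConnectionBubbleFourier
import HarnessLib

/-!
# Extraction word sums are trail remainders: `Σ_{u ∈ a_M-trails} τ_p(x − u(M)) = Rem_{[M]}(p;x)`,
# `Σ_{u₁,u₂} Σ_y τ_p(u₁, y) τ_p(y + u₂, x) ≤ Rem_{[M−m₂,m₂]}(p;x)`, and the repulsive-bubble cell at
# ABSTRACT remainder-kernel constants (b2b-lace, LEMMAS §20 node N68c-BRIDGE)

CITATION HEADER (PLACEMENT v2). This module is part of a certified REPRODUCTION of: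
R. Fitzner, R. van der Hofstad, *Mean-field behavior for nearest-neighbor percolation in d > 10*,
Electron. J. Probab. 22 (2017), no. 43 [FvdH17], §4.2, and *Generalized approach to the non-backtracking
lace expansion*, Probab. Theory Related Fields 169 (2017) 1041–1119 [NoBLE17], §5.3.1–§5.3.2.
Origin: build `lace`, staging package `LaceExpansionHighD`.

WHAT THIS FILE DOES. The literature seat's x-space EXTRACTION bounds ([FvdH17] (4.18), (4.20)–(4.21), the
display after (4.18) = [NoBLE17] (5.40); files `TwoPointTrailExtraction`, `DoubleConnectionBubble`,
`RepulsiveBubbleExtraction`) end in FINITE WORD SUMS over bond-avoiding words (`trailWords d M`) of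
two-point functions: a one-tail term `p^M Σ_{u} τ_p(0, x − u(M))` and a two-tail term
`p^M Σ_{(u₁,u₂)} Σ_{y∈S} τ_p(u₁(M−m₂), y) τ_p(y + u₂(m₂), x)`. The carver's frame (`NbwRemainderFrame`) bounds the
TRAIL REMAINDER `Rem_c(p;x) = ((a_{c₁} ⋆ ⋯ ⋆ a_{c_n}) ⋆ τ_p^{⋆n})(x)` (`trailRem d p c x`) by `Γ̄₂(p)ⁿ · R` for any
valid remainder-kernel constant `R` (`IsRemKernelConst d c X R`; printed `R = (2d)^M K_{n,M}`, N53 `R = J_n`).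
This file is the glue between the two (no new mathematics; [NoBLE17] (5.25) p. 1097 read literally):
* (A) word sums over trails are `x`-space pairings with the trail counts `a_n = trailLaw d n`:
  `Σ_{u ∈ trailWords d n} g(x − u(n)) = (a_n ⋆ g)(x)` (`sum_trailWords_eq_latticeConv`; finite support);
* (B) `pieces f [m] = f m`, `pieces f [m,n] = f m ⋆ f n`, and the PEEL lemma
  `((a_m ⋆ pieces c) ⋆ G)(x) = Σ_{u ∈ trailWords d m} (pieces c ⋆ G)(x − u(m))` for bounded `G`
  (`latticeConv_pieces_cons`; associativity `latticeConv_assoc_of_bdd`), whence `trailRem_cons`;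
* (C) ONE TAIL `Σ_u τ_p(0, x − u(M)) = Rem_{[M]}(p;x)` (`sum_trailWords_tau_eq_trailRem`), TWO TAILS
  `Σ_{(u₁,u₂)} Σ_{y∈S} τ_p(u₁(m), y) τ_p(y + u₂(n), x) ≤ Rem_{[m,n]}(p;x)` for every finite `S`, `p < p_c`
  (`sum_prod_trailWords_sum_tau_mul_tau_le_trailRem`; equality in the limit `S ↑ ℤ^d`);
* (D) SLOT FORM: with `IsRemKernelConst d [M] X R₁`, `IsRemKernelConst d [M−m₂,m₂] X R₂` and `x ∈ X` the
  (5.40)-shaped extraction right-hand side is at most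
  `Σ_{L=m₁+m₂}^{M−1} (L+1−m₁−m₂) a_L(x) p^L + (M−m₁−m₂) p^M Γ̄₂ R₁ + p^M Γ̄₂² R₂`, stated in hE-FORM: the extraction
  inequality is a HYPOTHESIS `hE` on an abstract non-negative `D : Site d → ℝ` (for the repulsive bubble
  `D y = 𝓑_{m₁,m₂}(y,x)` it is `RepulsiveBubbleExtraction.sum_diagB_le_extraction` of the literature seat, a
  kernel theorem — NOT a cited fact), and the conclusion is the cell-11 (`x = 0`) / cell-12 (`x ≠ 0`)
  repulsive-bubble bound of `Percolation.nb` at ABSTRACT slot constants — the form the re-cut oracle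
  `NobleImprovementInputsRemAt` (node N68g) consumes (`sum_le_repBubble_slots`, `sumLE_repBubble_slots`).
Compositions of length 3 and 4 (repulsive triangle / square) follow from the PEEL lemma in the same way once the
extraction right-hand sides are fixed.

[cite: FitznerVanDerHofstad2016NoBLE, §5.3.1 (5.23)–(5.25) pp. 1096–1097; §5.3.2 first display p. 1097, (5.40) p. 1098]
[cite: FitznerVanDerHofstad2017, §4.2 (4.18), (4.20)–(4.21) and the display after (4.18) (arXiv:1506.07977v2 pp. 36–37 = EJP pp. 33–34); notebook Percolation.nb cells 11, 12]
-/

noncomputable section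

namespace Literature.Probability.FitznerVanDerHofstad2017

open MeasureTheory Real Finset Filter
open scoped BigOperators
open Literature.Probability.LatticeModels
open Literature.Probability.Percolation
open Literature.Barriers.CriticalPhenomena
open Literature.Barriers.CriticalPhenomena.SpreadOutIsing (delta0 latticeConv convPow latticeConv_comm
  latticeConv_delta0_left latticeConv_delta0 latticeConv_assoc_of_bdd abs_latticeConv_le_of_bdd abs_convPow_le
  delta0_nonneg)

variable {d : ℕ}

/-! ### A. Word sums over trails as `x`-space pairings with `a_n` -/

/-- On the fibre over `y`: `Σ_{u ∈ n-trails to y} g(u(n)) = a_n(y) g(y)`. [folklore] -/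
theorem sum_trailWordsTo_eq (n : ℕ) (g : Site d → ℝ) (y : Site d) :
    ∑ u ∈ trailWordsTo d n y, g (wordPos u n) = trailLaw d n y * g y := by
  rw [trailLaw]
  have h : ∀ u ∈ trailWordsTo d n y, g (wordPos u n) = g y := fun u hu => by
    rw [(mem_trailWordsTo.1 hu).2]
  rw [Finset.sum_congr rfl h, Finset.sum_const, nsmul_eq_mul]

/-- `Σ_{u ∈ n-trails} g(u(n)) = Σ_{y ∈ endpoints} a_n(y) g(y)` (fibrewise count). [folklore] -/
theorem sum_trailWords_eq_sum_image (n : ℕ) (g : Site d → ℝ) :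
    ∑ u ∈ trailWords d n, g (wordPos u n) =
      ∑ y ∈ (trailWords d n).image (fun u => wordPos u n), trailLaw d n y * g y := by
  classical
  rw [← Finset.sum_fiberwise_of_maps_to (t := (trailWords d n).image fun u => wordPos u n)
    (g := fun u => wordPos u n) (fun u hu => Finset.mem_image_of_mem _ hu) (fun u => g (wordPos u n))]
  refine Finset.sum_congr rfl fun y _ => ?_
  rw [← sum_trailWordsTo_eq]
  refine Finset.sum_congr ?_ fun _ _ => rfl
  ext u
  simp only [Finset.mem_filter, mem_trailWords, mem_trailWordsTo]

/-- `a_n(y) = 0` off the set of endpoints of `n`-trails. [folklore] -/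
theorem trailLaw_eq_zero_of_not_mem {n : ℕ} {y : Site d}
    (hy : y ∉ (trailWords d n).image fun u => wordPos u n) : trailLaw d n y = 0 := by
  rw [trailLaw, Nat.cast_eq_zero, Finset.card_eq_zero, ← Finset.not_nonempty_iff_eq_empty]
  rintro ⟨u, hu⟩
  rw [mem_trailWordsTo] at hu
  exact hy (Finset.mem_image.2 ⟨u, mem_trailWords.2 hu.1, hu.2⟩)

/-- `y ↦ a_n(y) g(y)` has finite support, hence is summable. [folklore] -/
theorem summable_trailLaw_mul (n : ℕ) (g : Site d → ℝ) : Summable fun y => trailLaw d n y * g y :=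
  summable_of_ne_finset_zero (s := (trailWords d n).image fun u => wordPos u n)
    fun y hy => by rw [trailLaw_eq_zero_of_not_mem hy, zero_mul]

/-- `a_n` is summable (finite support). [folklore] -/
theorem summable_trailLaw (n : ℕ) : Summable (trailLaw d n) := by
  simpa using summable_trailLaw_mul n (fun _ => (1 : ℝ))

/-- `|a_n|` is summable. [folklore] -/
theorem summable_abs_trailLaw (n : ℕ) : Summable fun y => |trailLaw d n y| :=
  (summable_trailLaw n).abs

/-- **Word sum = pairing with `a_n`**: `Σ_{u ∈ n-trails} g(u(n)) = Σ_y a_n(y) g(y)`.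
[cite: FitznerVanDerHofstad2016NoBLE, §5.3.1 p. 1096 (a_n(x))] -/
theorem sum_trailWords_eq_tsum (n : ℕ) (g : Site d → ℝ) :
    ∑ u ∈ trailWords d n, g (wordPos u n) = ∑' y, trailLaw d n y * g y := by
  rw [sum_trailWords_eq_sum_image, tsum_eq_sum]
  intro y hy
  rw [trailLaw_eq_zero_of_not_mem hy, zero_mul]

/-- **Shifted word sum = convolution**: `Σ_{u ∈ n-trails} g(x − u(n)) = (a_n ⋆ g)(x)`.
[cite: FitznerVanDerHofstad2016NoBLE, (5.25) p. 1097] -/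
theorem sum_trailWords_eq_latticeConv (n : ℕ) (g : Site d → ℝ) (x : Site d) :
    ∑ u ∈ trailWords d n, g (x - wordPos u n) = latticeConv (trailLaw d n) g x :=
  sum_trailWords_eq_tsum n (fun y => g (x - y))

/-! ### B. Pieces of short compositions; the peel lemma -/

/-- `pieces f [m] = f m`. [folklore] -/
theorem pieces_singleton (f : ℕ → Site d → ℝ) (m : ℕ) : pieces f [m] = f m :=
  funext fun y => by rw [pieces_cons, pieces_nil, latticeConv_delta0]

/-- `pieces f [m, n] = f m ⋆ f n`. [folklore] -/
theorem pieces_pair (f : ℕ → Site d → ℝ) (m n : ℕ) : pieces f [m, n] = latticeConv (f m) (f n) := by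
  rw [pieces_cons, pieces_singleton]

/-- **PEEL**: `((a_m ⋆ pieces c) ⋆ G)(x) = Σ_{u ∈ m-trails} (pieces c ⋆ G)(x − u(m))` for bounded `G`.
[cite: FitznerVanDerHofstad2016NoBLE, (5.25) p. 1097] -/
theorem latticeConv_pieces_cons {G : Site d → ℝ} {B : ℝ} (hG : ∀ y, |G y| ≤ B) (m : ℕ) (c : List ℕ)
    (x : Site d) :
    latticeConv (pieces (trailLaw d) (m :: c)) G x =
      ∑ u ∈ trailWords d m, latticeConv (pieces (trailLaw d) c) G (x - wordPos u m) := by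
  rw [pieces_cons, latticeConv_assoc_of_bdd (summable_abs_trailLaw m)
    ((summable_pieces (fun k => summable_trailLaw (d := d) k) c).abs) hG, sum_trailWords_eq_latticeConv]

/-- `|τ_p^{⋆n}(y)| ≤ (Σ_z τ_p(z))ⁿ` below `p_c`. [folklore] -/
theorem abs_convPow_tau_le (hd : 2 ≤ d) (p : unitInterval) (hp : p < criticalProbI d) (n : ℕ) (y : Site d) :
    |convPow (tau d p 0) n y| ≤ (∑' z, |tau d p 0 z|) ^ n := by
  have hp' : (p : ℝ) < criticalProb (zdGraph d) (0 : Site d) := hp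
  exact abs_convPow_le (summable_tau_of_lt_criticalProb hd p hp').abs n y

/-- **`Rem` peeled**: `Rem_{m :: c}(p;x) = Σ_{u ∈ m-trails} (pieces c ⋆ τ_p^{⋆(|c|+1)})(x − u(m))` (`p < p_c`).
[cite: FitznerVanDerHofstad2016NoBLE, (5.25) p. 1097] -/
theorem trailRem_cons (hd : 2 ≤ d) (p : unitInterval) (hp : p < criticalProbI d) (m : ℕ) (c : List ℕ)
    (x : Site d) :
    trailRem d p (m :: c) x = ∑ u ∈ trailWords d m,
      latticeConv (pieces (trailLaw d) c) (convPow (tau d p 0) (c.length + 1)) (x - wordPos u m) := by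
  rw [trailRem, List.length_cons]
  exact latticeConv_pieces_cons (abs_convPow_tau_le hd p hp _) m c x

/-! ### C. One tail and two tails -/

/-- `Rem_{[M]}(p;x) = (a_M ⋆ τ_p)(x)`. [cite: FitznerVanDerHofstad2016NoBLE, (5.25) p. 1097] -/
theorem trailRem_singleton (p : unitInterval) (M : ℕ) (x : Site d) :
    trailRem d p [M] x = latticeConv (trailLaw d M) (tau d p 0) x := by
  rw [trailRem, pieces_singleton, List.length_singleton, convPow_tau_one]

/-- **ONE TAIL**: `Σ_{u ∈ M-trails} τ_p(0, x − u(M)) = Rem_{[M]}(p;x)`.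
[cite: FitznerVanDerHofstad2016NoBLE, (5.23), (5.25) p. 1097] -/
theorem sum_trailWords_tau_eq_trailRem (p : unitInterval) (M : ℕ) (x : Site d) :
    ∑ u ∈ trailWords d M, tau d p 0 (x - wordPos u M) = trailRem d p [M] x := by
  rw [trailRem_singleton]
  exact sum_trailWords_eq_latticeConv M (tau d p 0) x

/-- ONE TAIL at the origin in the `τ_p(u(M), 0)` form of `TwoPointTrailExtraction` / `DoubleConnectionBubble`.
[cite: FitznerVanDerHofstad2017, §4.2 (4.18) (arXiv:1506.07977v2 p. 36)] -/
theorem sum_trailWords_tau_zero_eq_trailRem (p : unitInterval) (M : ℕ) :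
    ∑ u ∈ trailWords d M, tau d p (wordPos u M) 0 = trailRem d p [M] 0 := by
  rw [← sum_trailWords_tau_eq_trailRem]
  refine Finset.sum_congr rfl fun u _ => ?_
  rw [tau_eq_tau_zero_sub]

/-- `Σ_{y∈S} τ_p(a, y) τ_p(y + b, x) ≤ τ_p^{⋆2}(x − b − a)` (`p < p_c`; equality for `S = ℤ^d`). [folklore] -/
theorem sum_tau_mul_tau_shift_le (hd : 2 ≤ d) (p : unitInterval) (hp : p < criticalProbI d)
    (a b x : Site d) (S : Finset (Site d)) :
    ∑ y ∈ S, tau d p a y * tau d p (y + b) x ≤ convPow (tau d p 0) 2 (x - b - a) := by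
  have h1 : ∀ y, tau d p (y + b) x = tau d p (x - b) y := fun y => by
    rw [tau_comm p (y + b) x, tau_eq_tau_zero_sub p x (y + b), tau_eq_tau_zero_sub p (x - b) y]
    congr 1
    abel
  simp_rw [h1]
  rw [← tsum_tau_mul_tau_eq p a (x - b)]
  exact Summable.sum_le_tsum S (fun y _ => mul_nonneg (tau_nonneg p _ _) (tau_nonneg p _ _))
    (summable_tau_mul_tau hd p hp a (x - b))

/-- `Rem_{[m,n]}(p;x) = Σ_{u₁ ∈ m-trails} Σ_{u₂ ∈ n-trails} τ_p^{⋆2}(x − u₁(m) − u₂(n))` (`p < p_c`).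
[cite: FitznerVanDerHofstad2016NoBLE, (5.25) p. 1097] -/
theorem trailRem_pair_eq (hd : 2 ≤ d) (p : unitInterval) (hp : p < criticalProbI d) (m n : ℕ) (x : Site d) :
    trailRem d p [m, n] x = ∑ u₁ ∈ trailWords d m, ∑ u₂ ∈ trailWords d n,
      convPow (tau d p 0) 2 (x - wordPos u₁ m - wordPos u₂ n) := by
  rw [trailRem_cons hd p hp m [n] x]
  refine Finset.sum_congr rfl fun u₁ _ => ?_
  rw [List.length_singleton, one_add_one_eq_two, pieces_singleton, ← sum_trailWords_eq_latticeConv]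

/-- **TWO TAILS**: `Σ_{(u₁,u₂) ∈ m-trails × n-trails} Σ_{y∈S} τ_p(u₁(m), y) τ_p(y + u₂(n), x) ≤ Rem_{[m,n]}(p;x)`
for every finite `S` (`p < p_c`) — the two-tail family of the repulsive-bubble extraction.
[cite: FitznerVanDerHofstad2016NoBLE, (5.25) p. 1097, (5.40) p. 1098]
[cite: FitznerVanDerHofstad2017, §4.2 display after (4.18) (arXiv:1506.07977v2 p. 36)] -/
theorem sum_prod_trailWords_sum_tau_mul_tau_le_trailRem (hd : 2 ≤ d) (p : unitInterval)
    (hp : p < criticalProbI d) (m n : ℕ) (x : Site d) (S : Finset (Site d)) :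
    ∑ uu ∈ (trailWords d m) ×ˢ (trailWords d n),
        ∑ y ∈ S, tau d p (wordPos uu.1 m) y * tau d p (y + wordPos uu.2 n) x ≤ trailRem d p [m, n] x := by
  rw [trailRem_pair_eq hd p hp, Finset.sum_product]
  exact Finset.sum_le_sum fun u₁ _ => Finset.sum_le_sum fun u₂ _ =>
    (sum_tau_mul_tau_shift_le hd p hp _ _ x S).trans (le_of_eq (by rw [sub_right_comm]))

/-! ### D. Slot form: valid remainder-kernel constants -/

/-- ONE TAIL against a valid constant: `Σ_u τ_p(0, x − u(M)) ≤ Γ̄₂(p) R` for `x ∈ X`.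
[cite: FitznerVanDerHofstad2016NoBLE, §5.3.2 first display p. 1097] -/
theorem sum_trailWords_tau_le_slot {M : ℕ} {X : Set (Site d)} {R : ℝ} (hR : IsRemKernelConst d [M] X R)
    (p : unitInterval) (hp : p < criticalProbI d) {x : Site d} (hx : x ∈ X) :
    ∑ u ∈ trailWords d M, tau d p 0 (x - wordPos u M) ≤ nobleSup2 d p * R := by
  rw [sum_trailWords_tau_eq_trailRem]
  simpa using hR p hp x hx

/-- TWO TAILS against a valid constant: `Σ_{(u₁,u₂)} Σ_{y∈S} τ_p(u₁(m), y) τ_p(y + u₂(n), x) ≤ Γ̄₂(p)² R`.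
[cite: FitznerVanDerHofstad2016NoBLE, §5.3.2 first display p. 1097] -/
theorem sum_prod_trailWords_le_slot (hd : 2 ≤ d) {m n : ℕ} {X : Set (Site d)} {R : ℝ}
    (hR : IsRemKernelConst d [m, n] X R) (p : unitInterval) (hp : p < criticalProbI d) {x : Site d}
    (hx : x ∈ X) (S : Finset (Site d)) :
    ∑ uu ∈ (trailWords d m) ×ˢ (trailWords d n),
        ∑ y ∈ S, tau d p (wordPos uu.1 m) y * tau d p (y + wordPos uu.2 n) x ≤ nobleSup2 d p ^ 2 * R :=
  (sum_prod_trailWords_sum_tau_mul_tau_le_trailRem hd p hp m n x S).trans (by simpa using hR p hp x hx)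

/-! ### E. The repulsive-bubble cell at abstract slot constants (hE-form)

`hE` below is the literal shape of the literature seat's `RepulsiveBubbleExtraction.sum_diagB_le_extraction`
([NoBLE17] (5.40) / [FvdH17] display after (4.18)) for `D y = 𝓑_{m₁,m₂}(y,x)`; it is a HYPOTHESIS here,
discharged by that kernel theorem — NOT a cited fact (ABSOLUTE RULE). -/

section RepulsiveBubbleCell

variable {p : unitInterval} {m₁ m₂ M : ℕ} {x : Site d} {D : Site d → ℝ}
  (hE : ∀ S : Finset (Site d), ∑ y ∈ S, D y ≤
    (∑ L ∈ Finset.Ico (m₁ + m₂) M,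
        ((Finset.Icc m₁ (L - m₂)).card : ℝ) * ((trailWordsTo d L x).card : ℝ) * (p : ℝ) ^ L) +
      ((Finset.Ico m₁ (M - m₂)).card : ℝ) *
          ((p : ℝ) ^ M * ∑ u ∈ trailWords d M, tau d p 0 (x - wordPos u M)) +
        (p : ℝ) ^ (M - m₂) * (p : ℝ) ^ m₂ *
          ∑ uu ∈ (trailWords d (M - m₂)) ×ˢ (trailWords d m₂),
            ∑ y ∈ S, tau d p (wordPos uu.1 (M - m₂)) y * tau d p (y + wordPos uu.2 m₂) x)

include hE

/-- **The repulsive bubble at abstract remainder-kernel constants, all finite `S`** (`d ≥ 2`, `p < p_c`,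
`m₂ ≤ M`, `x ∈ X`; `R₁` valid for `[M]`, `R₂` valid for `[M−m₂, m₂]` on `X`):
`Σ_{y∈S} D(y) ≤ Σ_{L=m₁+m₂}^{M−1} (L+1−m₁−m₂) a_L(x) p^L + (M−m₁−m₂) p^M Γ̄₂ R₁ + p^M Γ̄₂² R₂` — the
`Percolation.nb` cell-11 (`x = 0`) / cell-12 (`x ≠ 0`) repulsive-bubble bound with the two remainder reads as slots.
[cite: FitznerVanDerHofstad2016NoBLE, (5.40) p. 1098; §5.3.2 first display p. 1097]
[cite: FitznerVanDerHofstad2017, notebook Percolation.nb cells 11, 12] -/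
theorem sum_le_repBubble_slots (hd : 2 ≤ d) (hp : p < criticalProbI d) (hm : m₂ ≤ M) {X : Set (Site d)}
    (hx : x ∈ X) {R₁ R₂ : ℝ} (hR₁ : IsRemKernelConst d [M] X R₁)
    (hR₂ : IsRemKernelConst d [M - m₂, m₂] X R₂) (S : Finset (Site d)) :
    ∑ y ∈ S, D y ≤
      (∑ L ∈ Finset.Ico (m₁ + m₂) M,
          ((L + 1 - m₁ - m₂ : ℕ) : ℝ) * ((trailWordsTo d L x).card : ℝ) * (p : ℝ) ^ L) +
        ((M - m₁ - m₂ : ℕ) : ℝ) * ((p : ℝ) ^ M * (nobleSup2 d p * R₁)) +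
          (p : ℝ) ^ M * (nobleSup2 d p ^ 2 * R₂) := by
  have hp0 : 0 ≤ (p : ℝ) := p.2.1
  refine (hE S).trans (add_le_add (add_le_add (le_of_eq ?_) ?_) ?_)
  · refine Finset.sum_congr rfl fun L hL => ?_
    rw [Finset.mem_Ico] at hL
    rw [Nat.card_Icc]
    congr 3
    omega
  · rw [Nat.card_Ico]
    have hc : M - m₂ - m₁ = M - m₁ - m₂ := by omega
    rw [hc]
    exact mul_le_mul_of_nonneg_left
      (mul_le_mul_of_nonneg_left (sum_trailWords_tau_le_slot hR₁ p hp hx) (pow_nonneg hp0 M))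
      (Nat.cast_nonneg _)
  · rw [← pow_add, Nat.sub_add_cancel hm]
    exact mul_le_mul_of_nonneg_left (sum_prod_trailWords_le_slot hd hR₂ p hp hx S) (pow_nonneg hp0 M)

/-- **The repulsive bubble at abstract slots, summed over `ℤ^d`**: for non-negative `D` the family is summable
and `Σ_y D(y)` obeys the same bound (`SumLE`). [cite: FitznerVanDerHofstad2016NoBLE, (5.40) p. 1098] -/
theorem sumLE_repBubble_slots (hD : ∀ y, 0 ≤ D y) (hd : 2 ≤ d) (hp : p < criticalProbI d) (hm : m₂ ≤ M)
    {X : Set (Site d)} (hx : x ∈ X) {R₁ R₂ : ℝ} (hR₁ : IsRemKernelConst d [M] X R₁)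
    (hR₂ : IsRemKernelConst d [M - m₂, m₂] X R₂) :
    SumLE D
      ((∑ L ∈ Finset.Ico (m₁ + m₂) M,
          ((L + 1 - m₁ - m₂ : ℕ) : ℝ) * ((trailWordsTo d L x).card : ℝ) * (p : ℝ) ^ L) +
        ((M - m₁ - m₂ : ℕ) : ℝ) * ((p : ℝ) ^ M * (nobleSup2 d p * R₁)) +
          (p : ℝ) ^ M * (nobleSup2 d p ^ 2 * R₂)) :=
  sumLE_of_finset_sum_le hD fun S => sum_le_repBubble_slots hE hd hp hm hx hR₁ hR₂ S

end RepulsiveBubbleCell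

end Literature.Probability.FitznerVanDerHofstad2017

end
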